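import Summits.CriticalPhenomena.SAWScalingLimit.Theorems.SAWDevelopingMapObservableToSLETypeLadderCarvedReductionSqueezeSuperSup
import Summits.CriticalPhenomena.SAWScalingLimit.Theorems.SAWDevelopingMapObservableToSLETypeLadderCarvedReductionSqueezeLimitPackage
import HarnessLib

/-!
# The limit data of the squeeze, bundled (piece (T-A′₂F limit data) of stub T-A′₂F
# `stub_carvedReduction_squeezeGeometry_domainsCoreF`)

Crux `SAWDevelopingMap.ObservableToSLE` (stmt-CriticalPhenomena-10472), line `six-class-type-ladder`,
stub T-A′₂F `stub_carvedReduction_squeezeGeometry_domainsCoreF`.  Landing target: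
`Summits/CriticalPhenomena/SAWScalingLimit/Theorems/SAWDevelopingMapObservableToSLETypeLadderCarvedReductionSqueezeLimitData.lean`.

The assembly of T-A′₂F passes through ~70 facts about the limit of the carved families along the
final subsequence `κ` (the STAGE-1a facts, the limit package `squeeze_limitPackage`, the connectors
`connector_limits` of both sides, the tame-family bookkeeping, the super-domain `superSup` with
its sequel clauses, the Schoenflies map of `D`, the unpinned gate windows).  To keep the statements
of the assembling theorems short, this file bundles them in ONE structure `SqueezeLimit`, whose
fields are these facts verbatim (pinned points `ṽ = δ(κ j) c_v - δ(κ j) triEmbed (x j)`, removed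
levels `S (κ j) (n (κ j))`, `T (κ j) (n' (κ j))`).  No mathematics here.
Registered carrier: `stub_carvedReduction_limitData`.
-/

noncomputable section

open scoped Topology
open Filter Set Metric MeasureTheory
open Literature.Probability.LatticeModels (HexVertex hexGraph hexCenter triEmbed Site)
open Literature.Probability.RandomPlanarGeometry
open Literature.Probability.RandomPlanarGeometry.SAW

namespace Summit.CriticalPhenomena.SAWScalingLimit.Theorems.ObservableToSLE.TypeLadder

open Summit.CriticalPhenomena.SAWScalingLimit.Theorems.ObservableToSLER.BridgeGate
open Summit.CriticalPhenomena.SAWScalingLimit.Theorems.ObservableToSLER.NestedGate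
open Summit.CriticalPhenomena.SAWScalingLimit.Theorems.ObservableToSLER.TwoPiece

/-- **The limit package with connectors along a subsequence `κ`** (the first stage of the
bundling: `squeeze_limitPackage`, `connector_limits` for both sides, the tame-family
bookkeeping, and the STAGE-1a facts reindexed). -/
structure SqueezePkg (D : DobrushinDomain) (a b : ℝ → HexVertex) (δ : ℕ → ℝ) (S T : ℕ → ℕ → Set HexVertex)
    (n n' : ℕ → ℕ) (q q' : ℕ → HexVertex) (κ : ℕ → ℕ) (ρ R : ℝ) (N : ℕ) (τ P₀ P₁ : ℂ) where
  /-- pinning sites -/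
  x : ℕ → Site 2
  /-- tracked cells -/
  gS : ℕ → Fin N → HexVertex × ℕ
  /-- tracked cells -/
  gT : ℕ → Fin N → HexVertex × ℕ
  /-- limit centres -/
  CS : Fin N → ℂ
  /-- limit centres -/
  CT : Fin N → ℂ
  /-- limit radii -/
  ϱS : Fin N → ℝ
  /-- limit radii -/
  ϱT : Fin N → ℝ
  /-- limit spines and bodies -/
  KS : Set ℂ
  /-- limit spines and bodies -/
  KT : Set ℂ
  /-- limit spines and bodies -/
  BS : Set ℂ
  /-- limit spines and bodies -/
  BT : Set ℂ
  /-- per-level bodies -/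
  BpS : ℕ → Set ℂ
  /-- per-level bodies -/
  BpT : ℕ → Set ℂ
  /-- connectors -/
  CcS : Fin N → ℂ
  /-- connectors -/
  CcT : Fin N → ℂ
  /-- dipping points -/
  WS : Fin N → ℂ
  /-- dipping points -/
  WT : Fin N → ℂ
  /-- connector radii -/
  ϱcS : Fin N → ℝ
  /-- connector radii -/
  ϱcT : Fin N → ℝ
  -- STAGE-1a facts
  spos : ∀ j, 0 < δ (κ j)
  santi : StrictAnti fun j => δ (κ j)
  s0 : Tendsto (fun j => δ (κ j)) atTop (𝓝[>] 0)
  hτ : Tendsto (fun j => ((δ (κ j) : ℝ) : ℂ) * triEmbed (x j)) atTop (𝓝 τ)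
  hconv : Tendsto (fun j => ((δ (κ j) : ℝ) : ℂ) * hexCenter (((q (κ j)).1 - x j, 0) : HexVertex)) atTop (𝓝 P₀)
  hconv' : Tendsto (fun j => ((δ (κ j) : ℝ) : ℂ) * hexCenter (((q' (κ j)).1 - x j, 0) : HexVertex)) atTop (𝓝 P₁)
  habove : ∀ j, P₀.im < (((δ (κ j) : ℝ) : ℂ) * hexCenter (((q (κ j)).1 - x j, 0) : HexVertex)).im
  habove' : ∀ j, P₁.im < (((δ (κ j) : ℝ) : ℂ) * hexCenter (((q' (κ j)).1 - x j, 0) : HexVertex)).im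
  hgate : Tendsto (fun j => ((δ (κ j) : ℝ) : ℂ) * hexCenter (q (κ j))) atTop (𝓝 (P₀ + τ))
  hgate' : Tendsto (fun j => ((δ (κ j) : ℝ) : ℂ) * hexCenter (q' (κ j))) atTop (𝓝 (P₁ + τ))
  hU : ∀ᶠ j in atTop, ∀ v : HexVertex,
    ((δ (κ j) : ℝ) : ℂ) * hexCenter v - ((δ (κ j) : ℝ) : ℂ) * triEmbed (x j) ∈ ball P₀ (ρ / 2) →
      (v ∈ S (κ j) (n (κ j)) ∪ T (κ j) (n' (κ j)) ↔ v.1 1 < (q (κ j)).1 1)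
  hU' : ∀ᶠ j in atTop, ∀ v : HexVertex,
    ((δ (κ j) : ℝ) : ℂ) * hexCenter v - ((δ (κ j) : ℝ) : ℂ) * triEmbed (x j) ∈ ball P₁ (ρ / 2) →
      (v ∈ S (κ j) (n (κ j)) ∪ T (κ j) (n' (κ j)) ↔ v.1 1 < (q' (κ j)).1 1)
  hballs : ∀ᶠ j in atTop, closedBall (P₀ + ((δ (κ j) : ℝ) : ℂ) * triEmbed (x j)) (ρ / 2) ⊆ D.carrier ∧
    closedBall (P₁ + ((δ (κ j) : ℝ) : ℂ) * triEmbed (x j)) (ρ / 2) ⊆ D.carrier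
  hqdom : ∀ j, q (κ j) ∈ embMeshDomain hexGraph hexCenter D.carrier (δ (κ j))
  hprob : ∀ᶠ j in atTop, IsProbabilityMeasure
    (carvedLaw D.carrier (δ (κ j)) (S (κ j) (n (κ j)) ∪ T (κ j) (n' (κ j))) (q (κ j)) (q' (κ j)))
  -- tame families and roots
  hSroot : ∀ j, a (δ (κ j)) ∈ S (κ j) (n (κ j))
  hTroot : ∀ j, b (δ (κ j)) ∈ T (κ j) (n' (κ j))
  hSloc : ∀ j, ∀ v ∈ S (κ j) (n (κ j)), dist (((δ (κ j) : ℝ) : ℂ) * hexCenter v) (((δ (κ j) : ℝ) : ℂ) * hexCenter (a (δ (κ j)))) ≤ R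
  hTloc : ∀ j, ∀ v ∈ T (κ j) (n' (κ j)), dist (((δ (κ j) : ℝ) : ℂ) * hexCenter v) (((δ (κ j) : ℝ) : ℂ) * hexCenter (b (δ (κ j)))) ≤ R
  hSpre : ∀ j, (hexGraph.induce (S (κ j) (n (κ j)))).Preconnected
  hTpre : ∀ j, (hexGraph.induce (T (κ j) (n' (κ j)))).Preconnected
  hroot0 : Tendsto (fun j => ((δ (κ j) : ℝ) : ℂ) * hexCenter (a (δ (κ j))) - ((δ (κ j) : ℝ) : ℂ) * triEmbed (x j)) atTop (𝓝 (D.pt 0 - τ))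
  hroot1 : Tendsto (fun j => ((δ (κ j) : ℝ) : ℂ) * hexCenter (b (δ (κ j))) - ((δ (κ j) : ℝ) : ℂ) * triEmbed (x j)) atTop (𝓝 (D.pt 1 - τ))
  -- the limit package
  hLS : ∀ j (v : HexVertex), v ∈ S (κ j) (n (κ j)) ↔ ∃ i, v ∈ hexBall (gS j i).1 (gS j i).2
  hLT : ∀ j (v : HexVertex), v ∈ T (κ j) (n' (κ j)) ↔ ∃ i, v ∈ hexBall (gT j i).1 (gT j i).2
  hϱS0 : ∀ i, 0 ≤ ϱS i
  hϱT0 : ∀ i, 0 ≤ ϱT i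
  hCS : ∀ i, Tendsto (fun j => ((δ (κ j) : ℝ) : ℂ) * hexCenter (gS j i).1 - ((δ (κ j) : ℝ) : ℂ) * triEmbed (x j)) atTop (𝓝 (CS i))
  hradS : ∀ i, Tendsto (fun j => δ (κ j) * ((gS j i).2 + 1 / 2)) atTop (𝓝 (ϱS i))
  hCT : ∀ i, Tendsto (fun j => ((δ (κ j) : ℝ) : ℂ) * hexCenter (gT j i).1 - ((δ (κ j) : ℝ) : ℂ) * triEmbed (x j)) atTop (𝓝 (CT i))
  hradT : ∀ i, Tendsto (fun j => δ (κ j) * ((gT j i).2 + 1 / 2)) atTop (𝓝 (ϱT i))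
  hpersS : ∀ ε > (0 : ℝ), ∀ᶠ j in atTop, ∀ (i : Fin N) (v : HexVertex),
    (∀ ℓ : Fin 3, |skewCoord ℓ (((δ (κ j) : ℝ) : ℂ) * hexCenter v - ((δ (κ j) : ℝ) : ℂ) * triEmbed (x j) - CS i)| ≤ ϱS i - ε) →
      v ∈ S (κ j) (n (κ j))
  hpersT : ∀ ε > (0 : ℝ), ∀ᶠ j in atTop, ∀ (i : Fin N) (v : HexVertex),
    (∀ ℓ : Fin 3, |skewCoord ℓ (((δ (κ j) : ℝ) : ℂ) * hexCenter v - ((δ (κ j) : ℝ) : ℂ) * triEmbed (x j) - CT i)| ≤ ϱT i - ε) →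
      v ∈ T (κ j) (n' (κ j))
  hcarve : ∀ K : Set ℂ, IsCompact K → (∀ i, Disjoint K {z : ℂ | ∀ ℓ : Fin 3, |skewCoord ℓ (z - CS i)| ≤ ϱS i}) →
    (∀ i, Disjoint K {z : ℂ | ∀ ℓ : Fin 3, |skewCoord ℓ (z - CT i)| ≤ ϱT i}) →
    ∀ᶠ j in atTop, ∀ v : HexVertex, v ∈ S (κ j) (n (κ j)) ∪ T (κ j) (n' (κ j)) →
      ((δ (κ j) : ℝ) : ℂ) * hexCenter v - ((δ (κ j) : ℝ) : ℂ) * triEmbed (x j) ∉ K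
  hKS : IsCompact KS ∧ IsConnected KS ∧ D.pt 0 - τ ∈ KS
  hKT : IsCompact KT ∧ IsConnected KT ∧ D.pt 1 - τ ∈ KT
  hKperS : ∀ ε > (0 : ℝ), ∀ᶠ j in atTop, ∀ v : HexVertex,
    infDist (((δ (κ j) : ℝ) : ℂ) * hexCenter v - ((δ (κ j) : ℝ) : ℂ) * triEmbed (x j)) KS ≤ ρ / 8 - ε → v ∈ S (κ j) (n (κ j))
  hKperT : ∀ ε > (0 : ℝ), ∀ᶠ j in atTop, ∀ v : HexVertex,
    infDist (((δ (κ j) : ℝ) : ℂ) * hexCenter v - ((δ (κ j) : ℝ) : ℂ) * triEmbed (x j)) KT ≤ ρ / 8 - ε → v ∈ T (κ j) (n' (κ j))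
  hBS : IsCompact BS ∧ IsConnected BS ∧ D.pt 0 - τ ∈ BS ∧ P₀ - ((ρ / 2 : ℝ) : ℂ) * Complex.I ∈ BS
  hBT : IsCompact BT ∧ IsConnected BT ∧ D.pt 1 - τ ∈ BT ∧ P₁ - ((ρ / 2 : ℝ) : ℂ) * Complex.I ∈ BT
  hBpS : ∀ j, IsCompact (BpS j) ∧ IsConnected (BpS j) ∧ ∀ v : HexVertex,
    infDist (((δ (κ j) : ℝ) : ℂ) * hexCenter v - ((δ (κ j) : ℝ) : ℂ) * triEmbed (x j)) (BpS j) ≤ ρ / 4 → v ∈ S (κ j) (n (κ j))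
  hBpT : ∀ j, IsCompact (BpT j) ∧ IsConnected (BpT j) ∧ ∀ v : HexVertex,
    infDist (((δ (κ j) : ℝ) : ℂ) * hexCenter v - ((δ (κ j) : ℝ) : ℂ) * triEmbed (x j)) (BpT j) ≤ ρ / 4 → v ∈ T (κ j) (n' (κ j))
  hHS : Tendsto (fun j => hausdorffDist (BpS j) BS) atTop (𝓝 0)
  hHT : Tendsto (fun j => hausdorffDist (BpT j) BT) atTop (𝓝 0)
  hbodyper : ∀ ε₁ > (0 : ℝ), ∀ᶠ j in atTop, ∀ v : HexVertex,
    (infDist (((δ (κ j) : ℝ) : ℂ) * hexCenter v - ((δ (κ j) : ℝ) : ℂ) * triEmbed (x j)) BS ≤ ρ / 4 - ε₁ → v ∈ S (κ j) (n (κ j))) ∧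
    (infDist (((δ (κ j) : ℝ) : ℂ) * hexCenter v - ((δ (κ j) : ℝ) : ℂ) * triEmbed (x j)) BT ≤ ρ / 4 - ε₁ → v ∈ T (κ j) (n' (κ j)))
  -- connectors
  hϱcS0 : ∀ i, 0 ≤ ϱcS i
  hϱcT0 : ∀ i, 0 ≤ ϱcT i
  hCcS : ∀ i (ℓ : Fin 3), |skewCoord ℓ (CS i - CcS i)| ≤ ϱcS i
  hCcT : ∀ i (ℓ : Fin 3), |skewCoord ℓ (CT i - CcT i)| ≤ ϱcT i
  hWS : ∀ i (ℓ : Fin 3), |skewCoord ℓ (WS i - CcS i)| ≤ ϱcS i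
  hWT : ∀ i (ℓ : Fin 3), |skewCoord ℓ (WT i - CcT i)| ≤ ϱcT i
  hWKS : ∀ i, infDist (WS i) KS ≤ ρ / 16
  hWKT : ∀ i, infDist (WT i) KT ≤ ρ / 16
  hconnS : ∀ ε > (0 : ℝ), ∀ᶠ j in atTop, ∀ (i : Fin N) (v : HexVertex),
    (∀ ℓ : Fin 3, |skewCoord ℓ (((δ (κ j) : ℝ) : ℂ) * hexCenter v - ((δ (κ j) : ℝ) : ℂ) * triEmbed (x j) - CcS i)| ≤ ϱcS i - ε) →
      v ∈ S (κ j) (n (κ j))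
  hconnT : ∀ ε > (0 : ℝ), ∀ᶠ j in atTop, ∀ (i : Fin N) (v : HexVertex),
    (∀ ℓ : Fin 3, |skewCoord ℓ (((δ (κ j) : ℝ) : ℂ) * hexCenter v - ((δ (κ j) : ℝ) : ℂ) * triEmbed (x j) - CcT i)| ≤ ϱcT i - ε) →
      v ∈ T (κ j) (n' (κ j))

/-- **The limit data of the squeeze along the final subsequence `κ`**; see the module docstring. -/
structure SqueezeLimit (D : DobrushinDomain) (a b : ℝ → HexVertex) (δ : ℕ → ℝ) (S T : ℕ → ℕ → Set HexVertex)
    (n n' : ℕ → ℕ) (q q' : ℕ → HexVertex) (κ : ℕ → ℕ) (ρ R : ℝ) (N : ℕ) where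
  /-- pinning sites -/
  x : ℕ → Site 2
  /-- limit drift -/
  τ : ℂ
  /-- limit gates -/
  P₀ : ℂ
  /-- limit gates -/
  P₁ : ℂ
  /-- the super-domain -/
  E : DobrushinDomain
  /-- its envelope -/
  J : JordanDomain
  /-- the cuts -/
  L : Fin 2 → Set ℂ
  /-- the exit regions -/
  F : Fin 2 → Set ℂ
  /-- the cut ends -/
  xx : Fin 2 → Fin 2 → ℂ
  /-- tracked cells -/
  gS : ℕ → Fin N → HexVertex × ℕ
  /-- tracked cells -/
  gT : ℕ → Fin N → HexVertex × ℕ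
  /-- limit centres -/
  CS : Fin N → ℂ
  /-- limit centres -/
  CT : Fin N → ℂ
  /-- limit radii -/
  ϱS : Fin N → ℝ
  /-- limit radii -/
  ϱT : Fin N → ℝ
  /-- limit spines and bodies -/
  KS : Set ℂ
  /-- limit spines and bodies -/
  KT : Set ℂ
  /-- limit spines and bodies -/
  BS : Set ℂ
  /-- limit spines and bodies -/
  BT : Set ℂ
  /-- connectors -/
  CcS : Fin N → ℂ
  /-- connectors -/
  CcT : Fin N → ℂ
  /-- dipping points -/
  WS : Fin N → ℂ
  /-- dipping points -/
  WT : Fin N → ℂ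
  /-- connector radii -/
  ϱcS : Fin N → ℝ
  /-- connector radii -/
  ϱcT : Fin N → ℝ
  /-- Schoenflies map of `D` -/
  H : ℂ ≃ₜ ℂ
  -- smallness
  hρ : 0 < ρ
  hρR : ρ ≤ R
  hsep : 2 * (R + ρ) < dist (D.pt 0) (D.pt 1)
  -- STAGE-1a facts
  spos : ∀ j, 0 < δ (κ j)
  santi : StrictAnti fun j => δ (κ j)
  s0 : Tendsto (fun j => δ (κ j)) atTop (𝓝[>] 0)
  hτ : Tendsto (fun j => ((δ (κ j) : ℝ) : ℂ) * triEmbed (x j)) atTop (𝓝 τ)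
  hq2 : ∀ j, (q (κ j)).2 = 0
  hq2' : ∀ j, (q' (κ j)).2 = 0
  hconv : Tendsto (fun j => ((δ (κ j) : ℝ) : ℂ) * hexCenter (((q (κ j)).1 - x j, 0) : HexVertex)) atTop (𝓝 P₀)
  hconv' : Tendsto (fun j => ((δ (κ j) : ℝ) : ℂ) * hexCenter (((q' (κ j)).1 - x j, 0) : HexVertex)) atTop (𝓝 P₁)
  habove : ∀ j, P₀.im < (((δ (κ j) : ℝ) : ℂ) * hexCenter (((q (κ j)).1 - x j, 0) : HexVertex)).im
  habove' : ∀ j, P₁.im < (((δ (κ j) : ℝ) : ℂ) * hexCenter (((q' (κ j)).1 - x j, 0) : HexVertex)).im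
  hU : ∀ᶠ j in atTop, ∀ v : HexVertex,
    ((δ (κ j) : ℝ) : ℂ) * hexCenter v - ((δ (κ j) : ℝ) : ℂ) * triEmbed (x j) ∈ ball P₀ (ρ / 2) →
      (v ∈ S (κ j) (n (κ j)) ∪ T (κ j) (n' (κ j)) ↔ v.1 1 < (q (κ j)).1 1)
  hU' : ∀ᶠ j in atTop, ∀ v : HexVertex,
    ((δ (κ j) : ℝ) : ℂ) * hexCenter v - ((δ (κ j) : ℝ) : ℂ) * triEmbed (x j) ∈ ball P₁ (ρ / 2) →
      (v ∈ S (κ j) (n (κ j)) ∪ T (κ j) (n' (κ j)) ↔ v.1 1 < (q' (κ j)).1 1)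
  hballs : ∀ᶠ j in atTop, closedBall (P₀ + ((δ (κ j) : ℝ) : ℂ) * triEmbed (x j)) (ρ / 2) ⊆ D.carrier ∧
    closedBall (P₁ + ((δ (κ j) : ℝ) : ℂ) * triEmbed (x j)) (ρ / 2) ⊆ D.carrier
  hqdom : ∀ j, q (κ j) ∈ embMeshDomain hexGraph hexCenter D.carrier (δ (κ j))
  hprob : ∀ᶠ j in atTop, IsProbabilityMeasure
    (carvedLaw D.carrier (δ (κ j)) (S (κ j) (n (κ j)) ∪ T (κ j) (n' (κ j))) (q (κ j)) (q' (κ j)))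
  -- tame families and roots
  hSroot : ∀ j, a (δ (κ j)) ∈ S (κ j) (n (κ j))
  hTroot : ∀ j, b (δ (κ j)) ∈ T (κ j) (n' (κ j))
  hSloc : ∀ j, ∀ v ∈ S (κ j) (n (κ j)), dist (((δ (κ j) : ℝ) : ℂ) * hexCenter v) (((δ (κ j) : ℝ) : ℂ) * hexCenter (a (δ (κ j)))) ≤ R
  hTloc : ∀ j, ∀ v ∈ T (κ j) (n' (κ j)), dist (((δ (κ j) : ℝ) : ℂ) * hexCenter v) (((δ (κ j) : ℝ) : ℂ) * hexCenter (b (δ (κ j)))) ≤ R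
  hSpre : ∀ j, (hexGraph.induce (S (κ j) (n (κ j)))).Preconnected
  hTpre : ∀ j, (hexGraph.induce (T (κ j) (n' (κ j)))).Preconnected
  hroot0 : Tendsto (fun j => ((δ (κ j) : ℝ) : ℂ) * hexCenter (a (δ (κ j))) - ((δ (κ j) : ℝ) : ℂ) * triEmbed (x j)) atTop (𝓝 (D.pt 0 - τ))
  hroot1 : Tendsto (fun j => ((δ (κ j) : ℝ) : ℂ) * hexCenter (b (δ (κ j))) - ((δ (κ j) : ℝ) : ℂ) * triEmbed (x j)) atTop (𝓝 (D.pt 1 - τ))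
  hPα : ∀ i : Fin 2, dist (![P₀, P₁] i) (![D.pt 0 - τ, D.pt 1 - τ] i) ≤ R
  hup : ∀ i : Fin 2, ∀ᶠ j in atTop, ∀ v : HexVertex,
    ((δ (κ j) : ℝ) : ℂ) * hexCenter v - ((δ (κ j) : ℝ) : ℂ) * triEmbed (x j) ∈ ball (![P₀, P₁] i) (ρ / 2) →
      v ∉ S (κ j) (n (κ j)) ∪ T (κ j) (n' (κ j)) →
        (![P₀, P₁] i).im < (((δ (κ j) : ℝ) : ℂ) * hexCenter v - ((δ (κ j) : ℝ) : ℂ) * triEmbed (x j)).im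
  hBfar : ∀ i : Fin 2, ∀ bb ∈ ![BS, BT] i, ∀ z : ℂ, dist z (![P₀, P₁] i) < ρ / 2 → (![P₀, P₁] i).im < z.im → ρ / 4 ≤ dist bb z
  hBR : ∀ i : Fin 2, ![BS, BT] i ⊆ closedBall (![D.pt 0 - τ, D.pt 1 - τ] i) R
  -- the limit package
  hLS : ∀ j (v : HexVertex), v ∈ S (κ j) (n (κ j)) ↔ ∃ i, v ∈ hexBall (gS j i).1 (gS j i).2
  hLT : ∀ j (v : HexVertex), v ∈ T (κ j) (n' (κ j)) ↔ ∃ i, v ∈ hexBall (gT j i).1 (gT j i).2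
  hϱS0 : ∀ i, 0 ≤ ϱS i
  hϱT0 : ∀ i, 0 ≤ ϱT i
  hCS : ∀ i, Tendsto (fun j => ((δ (κ j) : ℝ) : ℂ) * hexCenter (gS j i).1 - ((δ (κ j) : ℝ) : ℂ) * triEmbed (x j)) atTop (𝓝 (CS i))
  hradS : ∀ i, Tendsto (fun j => δ (κ j) * ((gS j i).2 + 1 / 2)) atTop (𝓝 (ϱS i))
  hCT : ∀ i, Tendsto (fun j => ((δ (κ j) : ℝ) : ℂ) * hexCenter (gT j i).1 - ((δ (κ j) : ℝ) : ℂ) * triEmbed (x j)) atTop (𝓝 (CT i))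
  hradT : ∀ i, Tendsto (fun j => δ (κ j) * ((gT j i).2 + 1 / 2)) atTop (𝓝 (ϱT i))
  hpersS : ∀ ε > (0 : ℝ), ∀ᶠ j in atTop, ∀ (i : Fin N) (v : HexVertex),
    (∀ ℓ : Fin 3, |skewCoord ℓ (((δ (κ j) : ℝ) : ℂ) * hexCenter v - ((δ (κ j) : ℝ) : ℂ) * triEmbed (x j) - CS i)| ≤ ϱS i - ε) →
      v ∈ S (κ j) (n (κ j))
  hpersT : ∀ ε > (0 : ℝ), ∀ᶠ j in atTop, ∀ (i : Fin N) (v : HexVertex),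
    (∀ ℓ : Fin 3, |skewCoord ℓ (((δ (κ j) : ℝ) : ℂ) * hexCenter v - ((δ (κ j) : ℝ) : ℂ) * triEmbed (x j) - CT i)| ≤ ϱT i - ε) →
      v ∈ T (κ j) (n' (κ j))
  hcarve : ∀ K : Set ℂ, IsCompact K → (∀ i, Disjoint K {z : ℂ | ∀ ℓ : Fin 3, |skewCoord ℓ (z - CS i)| ≤ ϱS i}) →
    (∀ i, Disjoint K {z : ℂ | ∀ ℓ : Fin 3, |skewCoord ℓ (z - CT i)| ≤ ϱT i}) →
    ∀ᶠ j in atTop, ∀ v : HexVertex, v ∈ S (κ j) (n (κ j)) ∪ T (κ j) (n' (κ j)) →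
      ((δ (κ j) : ℝ) : ℂ) * hexCenter v - ((δ (κ j) : ℝ) : ℂ) * triEmbed (x j) ∉ K
  hKS : IsCompact KS ∧ IsConnected KS ∧ D.pt 0 - τ ∈ KS
  hKT : IsCompact KT ∧ IsConnected KT ∧ D.pt 1 - τ ∈ KT
  hKperS : ∀ ε > (0 : ℝ), ∀ᶠ j in atTop, ∀ v : HexVertex,
    infDist (((δ (κ j) : ℝ) : ℂ) * hexCenter v - ((δ (κ j) : ℝ) : ℂ) * triEmbed (x j)) KS ≤ ρ / 8 - ε → v ∈ S (κ j) (n (κ j))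
  hKperT : ∀ ε > (0 : ℝ), ∀ᶠ j in atTop, ∀ v : HexVertex,
    infDist (((δ (κ j) : ℝ) : ℂ) * hexCenter v - ((δ (κ j) : ℝ) : ℂ) * triEmbed (x j)) KT ≤ ρ / 8 - ε → v ∈ T (κ j) (n' (κ j))
  hBS : IsCompact BS ∧ IsConnected BS ∧ D.pt 0 - τ ∈ BS ∧ P₀ - ((ρ / 2 : ℝ) : ℂ) * Complex.I ∈ BS
  hBT : IsCompact BT ∧ IsConnected BT ∧ D.pt 1 - τ ∈ BT ∧ P₁ - ((ρ / 2 : ℝ) : ℂ) * Complex.I ∈ BT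
  hBperS : ∀ ε > (0 : ℝ), ∀ᶠ j in atTop, ∀ v : HexVertex,
    infDist (((δ (κ j) : ℝ) : ℂ) * hexCenter v - ((δ (κ j) : ℝ) : ℂ) * triEmbed (x j)) BS ≤ ρ / 4 - ε → v ∈ S (κ j) (n (κ j))
  hBperT : ∀ ε > (0 : ℝ), ∀ᶠ j in atTop, ∀ v : HexVertex,
    infDist (((δ (κ j) : ℝ) : ℂ) * hexCenter v - ((δ (κ j) : ℝ) : ℂ) * triEmbed (x j)) BT ≤ ρ / 4 - ε → v ∈ T (κ j) (n' (κ j))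
  -- connectors
  hϱcS0 : ∀ i, 0 ≤ ϱcS i
  hϱcT0 : ∀ i, 0 ≤ ϱcT i
  hCcS : ∀ i (ℓ : Fin 3), |skewCoord ℓ (CS i - CcS i)| ≤ ϱcS i
  hCcT : ∀ i (ℓ : Fin 3), |skewCoord ℓ (CT i - CcT i)| ≤ ϱcT i
  hWS : ∀ i (ℓ : Fin 3), |skewCoord ℓ (WS i - CcS i)| ≤ ϱcS i
  hWT : ∀ i (ℓ : Fin 3), |skewCoord ℓ (WT i - CcT i)| ≤ ϱcT i
  hWKS : ∀ i, infDist (WS i) KS ≤ ρ / 16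
  hWKT : ∀ i, infDist (WT i) KT ≤ ρ / 16
  hconnS : ∀ ε > (0 : ℝ), ∀ᶠ j in atTop, ∀ (i : Fin N) (v : HexVertex),
    (∀ ℓ : Fin 3, |skewCoord ℓ (((δ (κ j) : ℝ) : ℂ) * hexCenter v - ((δ (κ j) : ℝ) : ℂ) * triEmbed (x j) - CcS i)| ≤ ϱcS i - ε) →
      v ∈ S (κ j) (n (κ j))
  hconnT : ∀ ε > (0 : ℝ), ∀ᶠ j in atTop, ∀ (i : Fin N) (v : HexVertex),
    (∀ ℓ : Fin 3, |skewCoord ℓ (((δ (κ j) : ℝ) : ℂ) * hexCenter v - ((δ (κ j) : ℝ) : ℂ) * triEmbed (x j) - CcT i)| ≤ ϱcT i - ε) →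
      v ∈ T (κ j) (n' (κ j))
  -- the super-domain
  hEpt0 : E.pt 0 = P₀
  hEpt1 : E.pt 1 = P₁
  hEflat : ∀ i, E.carrier ∩ ball (E.pt i) (ρ / 128) = {z : ℂ | (E.pt i).im < z.im} ∩ ball (E.pt i) (ρ / 128)
  hEbox : ∀ i (z : ℂ), |z.re - (E.pt i).re| ≤ ρ / 64 → (E.pt i).im - ρ / 128 ≤ z.im → z.im ≤ (E.pt i).im → z ∉ E.carrier
  hER : ∀ᶠ j in atTop, ∀ (w : HexVertex) (π : (hexDomainGraph D.carrier (δ (κ j))).Walk (q (κ j)) w),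
    (∀ y ∈ π.support, y ∉ S (κ j) (n (κ j)) ∪ T (κ j) (n' (κ j))) → ∀ y ∈ π.support,
      ((δ (κ j) : ℝ) : ℂ) * hexCenter y - ((δ (κ j) : ℝ) : ℂ) * triEmbed (x j) ∈ E.carrier ∧
      closedBall (((δ (κ j) : ℝ) : ℂ) * hexCenter y - ((δ (κ j) : ℝ) : ℂ) * triEmbed (x j)) (25 * δ (κ j)) ⊆
        E.carrier ∪ ⋃ i, {z : ℂ | |z.re - (E.pt i).re| ≤ ρ / 64 ∧ (E.pt i).im - 30 * δ (κ j) ≤ z.im ∧ z.im ≤ (E.pt i).im}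
  hEJ : E.carrier ⊆ J.carrier \ (L 0 ∪ L 1)
  hjoinE : ∀ z : ℂ, JoinedIn (J.carrier \ (L 0 ∪ L 1)) z (P₀ + ((((ρ / 128) / 2 : ℝ)) : ℂ) * Complex.I) → z ∈ E.carrier
  hfrE : frontier E.carrier ⊆ L 0 ∪ L 1 ∪ frontier J.carrier
  hDJ : closure ((fun z => z - τ) '' D.carrier) ⊆ J.carrier
  hcross : ∀ i, J.IsCrosscut (L i) (xx i 0) (xx i 1)
  hLcut : ∀ i, L i ⊆ gateO (![BS, BT] i) (F i) (![P₀, P₁] i) ρ ∪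
    (segment ℝ (![P₀, P₁] i - ((ρ / 64 : ℝ) : ℂ) - ((ρ / 128 : ℝ) : ℂ) * Complex.I) (![P₀, P₁] i - ((ρ / 64 : ℝ) : ℂ)) ∪
      segment ℝ (![P₀, P₁] i - ((ρ / 64 : ℝ) : ℂ)) (![P₀, P₁] i + ((ρ / 64 : ℝ) : ℂ)) ∪
      segment ℝ (![P₀, P₁] i + ((ρ / 64 : ℝ) : ℂ)) (![P₀, P₁] i + ((ρ / 64 : ℝ) : ℂ) - ((ρ / 128 : ℝ) : ℂ) * Complex.I)) ∪
    {xx i 0, xx i 1}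
  hFo : ∀ i, IsOpen (F i)
  hFJ : ∀ i, F i ⊆ J.carrier
  hFD : ∀ i, Disjoint (closure (F i)) (closure ((fun z => z - τ) '' D.carrier))
  -- the Schoenflies map of `D`
  hHball : H '' ball 0 1 = D.carrier
  hHcl : H '' closedBall 0 1 = closure D.carrier
  -- the unpinned gate windows and the wide link
  hwinq : ∀ᶠ j in atTop, ∀ v : HexVertex, ((δ (κ j) : ℝ) : ℂ) * hexCenter v ∈ ball (((δ (κ j) : ℝ) : ℂ) * hexCenter (q (κ j))) ρ →
    (v ∈ S (κ j) (n (κ j)) ∪ T (κ j) (n' (κ j)) ↔ v.1 1 < (q (κ j)).1 1)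
  hwinq' : ∀ᶠ j in atTop, ∀ v : HexVertex, ((δ (κ j) : ℝ) : ℂ) * hexCenter v ∈ ball (((δ (κ j) : ℝ) : ℂ) * hexCenter (q' (κ j))) ρ →
    (v ∈ S (κ j) (n (κ j)) ∪ T (κ j) (n' (κ j)) ↔ v.1 1 < (q' (κ j)).1 1)
  hballq : ∀ᶠ j in atTop, closedBall (((δ (κ j) : ℝ) : ℂ) * hexCenter (q (κ j))) ρ ⊆ D.carrier
  hballq' : ∀ᶠ j in atTop, closedBall (((δ (κ j) : ℝ) : ℂ) * hexCenter (q' (κ j))) ρ ⊆ D.carrier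
  hwide : ∀ᶠ j in atTop, WideLink D.carrier (δ (κ j)) ρ (S (κ j) (n (κ j)) ∪ T (κ j) (n' (κ j))) (q (κ j)) (q' (κ j))
  hconvq : Tendsto (fun j => ((δ (κ j) : ℝ) : ℂ) * hexCenter (q (κ j)) - ((δ (κ j) : ℝ) : ℂ) * triEmbed (x j)) atTop (𝓝 P₀)
  hconvq' : Tendsto (fun j => ((δ (κ j) : ℝ) : ℂ) * hexCenter (q' (κ j)) - ((δ (κ j) : ℝ) : ℂ) * triEmbed (x j)) atTop (𝓝 P₁)

/-- **Registered carrier `stub_carvedReduction_limitData`** (crux item stmt-CriticalPhenomena-10472,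
stub T-A′₂F `stub_carvedReduction_squeezeGeometry_domainsCoreF`, piece THE LIMIT DATA): the meshes of
a `SqueezeLimit` tend to `0`. -/
theorem stub_carvedReduction_limitData {D : DobrushinDomain} {a b : ℝ → HexVertex} {δ : ℕ → ℝ}
    {S T : ℕ → ℕ → Set HexVertex} {n n' : ℕ → ℕ} {q q' : ℕ → HexVertex} {κ : ℕ → ℕ} {ρ R : ℝ} {N : ℕ}
    (Λ : SqueezeLimit D a b δ S T n n' q q' κ ρ R N) : Tendsto (fun j => δ (κ j)) atTop (𝓝 0) :=
  Λ.s0.mono_right nhdsWithin_le_nhds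

end Summit.CriticalPhenomena.SAWScalingLimit.Theorems.ObservableToSLE.TypeLadder

end
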